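import Summits.QuantumFields.BalabanUV.T4Continuum.Support.NE7HdecompOfDbar
import Summits.QuantumFields.BalabanUV.T4Continuum.Support.NE3GaugeDirFrames
import Summits.QuantumFields.BalabanUV.T4Continuum.Support.NE3FrameFreeDecompositionLinear
import Summits.QuantumFields.BalabanUV.T4Continuum.Support.NE3CurlOfGaugeDir
import Summits.QuantumFields.BalabanUV.T4Continuum.Support.NE7ConstantFluxBackground
import Literature.MathematicalPhysics.QuantumFieldTheory.Balaban1983to89.B7BlockAvgLog
import Literature.MathematicalPhysics.QuantumFieldTheory.Balaban1983to89.B8Ineq130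
import HarnessLib

/-!
# NE7 (pub-balaban, rung (B)+1, d = 4, SU(2), L = 2): THE PURE-GAUGE DIPOLE WITNESS, I — the dipole profile, its generator, gauge and field

Cell `pub-balaban`, rung (B)+1 sub-cell t4, lineage `b2b-balaban-t4-ne7-p1` (CRUX PROVER NE7 #1 = OWNER of row NE7), generation 98; memo `t4/b2b-balaban-t4-ne7-p1-g98/ROAD-G98.md` §3.2.

WHY.  The un-primed ENDs `NE7HintOfTopNormalisedSU2.hint_SU2_of_topNormalised` (p745324) ∕ `NE7HintOfDbarSU2.hint_SU2_of_dbar` (p747587) ask the three slice masses of their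
hypothesis (B)∕(B′) of EVERY representative `(u, X, b)` of an admissible pair; the `m₁`-line `Σ_z‖μ(z)‖ ≤ m₁·M³·‖X‖_w²` is inhomogeneous (linear left, quadratic right).  The witness
killing it (file III, `NE7EndHypothesisBWitness`) is the PURE-GAUGE DIPOLE at the flat datum: `u(y) = exp(t·σ(y)·Λ₀)`, `σ = 𝟙_{a + PΛ} − 𝟙_{a′ + PΛ}` (`a = (1,0,0,0)`, `a′ = (1,1,0,0)`,
`P = 2N`, `Λ₀ = i·1`), `X = gaugeDir 1 (tσΛ₀)`.  THIS FILE (I): the profile `σ` and its arithmetic (periodic, zero on `2ℤ⁴`, `σ(a) = 1`, `|σ| ≤ 1`, BLOCK SUMS ZERO by the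
coordinate-1 flip of `{0,1}⁴`), the generator `λ = tσΛ₀`, the gauge `u = e^{λ}` (unitary, `= 1` on `2ℤ⁴`), the field `X = gaugeDir 1 λ` (skew, periodic, `sup ≤ 2t‖Λ₀‖`,
`1^{u} = 1·e^{X} = relPert 1 X`).

HONEST FRAMING (page 1): an explicit finite witness over landed kernel definitions; nothing of Bałaban's asserted or refuted; NE7 NOT PROVED; spine 0∕9; finite T⁴ rung (B)+1 — NOT
infinite volume, NOT mass gap, NOT `BetaPertH`, NOT Clay.  Continuum YM on T⁴ ⇐ BetaPertH ∧ nine spine estimates (0/9 proved).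

WHAT ([folklore]; witness abbreviations `clsA clsB dip siteA flip1 flipEquiv Lam0 lamD uD XD`, 0 sorry).
-/

namespace Summit.QuantumFields.BalabanUV.T4Continuum.NE7DipoleWitnessField

open scoped BigOperators Matrix Matrix.Norms.L2Operator Topology
open NormedSpace Finset

open Literature.MathematicalPhysics.QuantumFieldTheory.Balaban1983to89
open B7Prop1Explicit B7Prop2Explicit B7Prop3Flat MatrixLog UnitaryModel MatrixNorms
open T4AveragingDeficitWall (Ad IsUnitaryCfg IsSkewDir SmallField vary curl curlAt curlSq dirSq)
open T4AveragingDeficitWallBoundary (IsPeriodicCfg periodBox mem_periodBox)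
open AveragingDeficitPeriodicCounting (IsPeriodicDir)
open AveragingDeficitMultiLevelPrep (LevelSmall tower TangentIter cpush)
open AveragingDeficitTransport (mem_U1_of_unitary nReTr_eq_zero_of_mem_skewAdjoint curl_mem_skewAdjoint)
open AveragingDeficitNearIdentity (Ad_one)
open MinimalActionLevels (perWin)
open MinimalActionSandwich (admissible)
open MinimalActionRate (sfClass)
open NE3HessForm (dAction)
open NE3TangentCovariantTower (dirIter framePotW dirIter_one framePotW_one)
open NE3TangentCovariantStructure (Fbar cpush_gaugeDir)
open B7Eq92Concrete (vcov dbavgCovIter dbavgCovIter_succ dbavgCovIter_zero dbavgCov_one_left vcov_succ vcov_zero wframe_one_left)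
open NE3.PairLandauB8Avg (relPert)
open BlockAveragePushDirGauge (gaugeDir isPeriodicDir_gaugeDir)
open NE3CornerSpikes (spikeW)
open NE3QbarIterCovLiftPrep (cruxC)
open NE3SmoothRightInverseW (rightInvW)
open NE3RightInverseSolveLetters (thetaLoc)
open NE3RightInverseLetters (theta_lt_one_of_loc)
open NE3RightInverseSupLetters (norm_rightInvW_le)
open NE3EnergyShapes (IsUnitarySite IsPeriodicSite)
open NE3EnergyWeightedShapes (energyNormW)
open NE3FrameFreeSliceW (frameFreeBlockLandauW)
open NE3FrameFreeDecompositionLinear (zero_mem_frameFreeBlockLandauW)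
open NE3GaugeDirFrames (frameLin_gaugeDir)
open NE3CurlOfGaugeDir (curlAt_gaugeDir)
open NE7ConstantFluxBackground (expUnit_add_smul expUnit_real_smul_mem_unitary)
open NE7HdecompOfTopNormalised (levelSmall_d4_L2 radius_identities)
open B7BlockAvgLog (mlog_exp)
open B8Ineq130 (hol_one Wcx_one bavg_one)

noncomputable section

variable {n : Type} [Fintype n] [DecidableEq n]

/-! ## §1 The dipole profile on `ℤ⁴` with period `P` -/

/-- The residue class of `a = (1,0,0,0)` modulo `P`. -/
def clsA (P : ℕ) (y : Site 4) : Prop := (P : ℤ) ∣ y 0 - 1 ∧ (P : ℤ) ∣ y 1 ∧ (P : ℤ) ∣ y 2 ∧ (P : ℤ) ∣ y 3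

/-- The residue class of `a′ = (1,1,0,0)` modulo `P`. -/
def clsB (P : ℕ) (y : Site 4) : Prop := (P : ℤ) ∣ y 0 - 1 ∧ (P : ℤ) ∣ y 1 - 1 ∧ (P : ℤ) ∣ y 2 ∧ (P : ℤ) ∣ y 3

open Classical in
/-- The dipole profile `σ = 𝟙_{a + PΛ} − 𝟙_{a′ + PΛ}`. -/
def dip (P : ℕ) (y : Site 4) : ℝ := (if clsA P y then 1 else 0) - (if clsB P y then 1 else 0)

/-- `|σ| ≤ 1`. [folklore] -/
theorem abs_dip_le (P : ℕ) (y : Site 4) : |dip P y| ≤ 1 := by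
  unfold dip
  split_ifs <;> norm_num

/-- `σ` is `P`-periodic. [folklore] -/
theorem dip_periodic (P : ℕ) (y : Site 4) (i : Fin 4) : dip P (y + (P : ℤ) • e i) = dip P y := by
  classical
  have hc : ∀ (j : Fin 4) (c : ℤ), ((P : ℤ) ∣ (y + (P : ℤ) • e i) j - c) ↔ ((P : ℤ) ∣ y j - c) := by
    intro j c
    have : (y + (P : ℤ) • e i) j - c = (y j - c) + (P : ℤ) * (e i j) := by
      simp only [Pi.add_apply, Pi.smul_apply, smul_eq_mul]; ring
    rw [this]
    exact dvd_add_left (dvd_mul_right _ _)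
  have hc0 : ∀ (j : Fin 4), ((P : ℤ) ∣ (y + (P : ℤ) • e i) j) ↔ ((P : ℤ) ∣ y j) := by
    intro j; have h := hc j 0; simp only [sub_zero] at h; exact h
  have hA : clsA P (y + (P : ℤ) • e i) ↔ clsA P y := by
    unfold clsA; rw [hc 0 1, hc0 1, hc0 2, hc0 3]
  have hB : clsB P (y + (P : ℤ) • e i) ↔ clsB P y := by
    unfold clsB; rw [hc 0 1, hc 1 1, hc0 2, hc0 3]
  unfold dip
  rw [if_congr hA rfl rfl, if_congr hB rfl rfl]

/-- `σ` vanishes on `2ℤ⁴` when `P` is even. [folklore] -/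
theorem dip_corner {P : ℕ} (hP : 2 ∣ P) (w : Site 4) : dip P ((2 : ℤ) • w) = 0 := by
  have h2 : (2 : ℤ) ∣ (P : ℤ) := by exact_mod_cast Int.natCast_dvd_natCast.mpr hP
  have hodd : ¬ ((P : ℤ) ∣ ((2 : ℤ) • w) 0 - 1) := by
    intro h
    have h' := h2.trans h
    simp only [Pi.smul_apply, smul_eq_mul] at h'
    omega
  have hA : ¬ clsA P ((2 : ℤ) • w) := fun h => hodd h.1
  have hB : ¬ clsB P ((2 : ℤ) • w) := fun h => hodd h.1
  unfold dip
  rw [if_neg hA, if_neg hB, sub_zero]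

/-- The site `a = (1,0,0,0)`. -/
def siteA : Site 4 := fun i => if i = 0 then 1 else 0

/-- `σ(a) = 1` when `P ≥ 2`. [folklore] -/
theorem dip_siteA {P : ℕ} (hP : 2 ≤ P) : dip P siteA = 1 := by
  have hA : clsA P siteA := by
    refine ⟨?_, ?_, ?_, ?_⟩ <;> simp [siteA]
  have hB : ¬ clsB P siteA := by
    intro h
    have h1 := h.2.1
    simp only [siteA, Fin.one_eq_zero_iff, OfNat.ofNat_ne_one, ↓reduceIte, zero_sub] at h1
    have h1' : (P : ℤ) ∣ 1 := (dvd_neg).mp h1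
    have hP1 : (P : ℤ) ≤ 1 := Int.le_of_dvd one_pos h1'
    omega
  unfold dip
  rw [if_pos hA, if_neg hB, sub_zero]

/-- `a` lies in the period box `[0, P)⁴` when `P ≥ 2`. [folklore] -/
theorem siteA_mem_periodBox {P : ℕ} (hP : 2 ≤ P) : siteA ∈ periodBox (d := 4) P := by
  rw [mem_periodBox]
  intro κ
  by_cases h : κ = 0
  · subst h; simp [siteA]; omega
  · simp [siteA, h]; omega

/-- The coordinate-1 flip of `{0,1}⁴`. -/
def flip1 (r : Fin 4 → Fin 2) : Fin 4 → Fin 2 := Function.update r 1 (Fin.rev (r 1))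

/-- The flip is an involution. [folklore] -/
theorem flip1_flip1 (r : Fin 4 → Fin 2) : flip1 (flip1 r) = r := by
  funext i
  unfold flip1
  by_cases h : i = 1
  · subst h; simp
  · simp [Function.update_of_ne h]

/-- The flip as an equivalence. -/
def flipEquiv : (Fin 4 → Fin 2) ≃ (Fin 4 → Fin 2) := ⟨flip1, flip1, flip1_flip1, flip1_flip1⟩

/-- The flip exchanges the two residue classes inside every block of side `2` when `P` is even:
`2z + r ∈ a + PΛ ⟺ 2z + flip r ∈ a′ + PΛ`. [folklore] -/
theorem clsA_iff_clsB_flip {P : ℕ} (hP : 2 ∣ P) (z : Site 4) (r : Fin 4 → Fin 2) :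
    clsA P ((2 : ℤ) • z + boxVec 2 r) ↔ clsB P ((2 : ℤ) • z + boxVec 2 (flip1 r)) := by
  have h2 : (2 : ℤ) ∣ (P : ℤ) := by exact_mod_cast Int.natCast_dvd_natCast.mpr hP
  have hc : ∀ (s : Fin 4 → Fin 2) (j : Fin 4), ((2 : ℤ) • z + boxVec 2 s) j = 2 * z j + ((s j : ℕ) : ℤ) := by
    intro s j; simp [boxVec]
  have hf0 : flip1 r 0 = r 0 := by simp [flip1]
  have hf2 : flip1 r 2 = r 2 := by simp [flip1]
  have hf3 : flip1 r 3 = r 3 := by simp [flip1]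
  have hf1 : ((flip1 r 1 : ℕ) : ℤ) = 1 - ((r 1 : ℕ) : ℤ) := by
    have hlt : (r 1 : ℕ) < 2 := (r 1).isLt
    simp only [flip1, Function.update_self, Fin.val_rev]
    omega
  -- the middle coordinate: `P ∣ 2 z₁ + r₁ ⟺ P ∣ 2 z₁ + (1 − r₁) − 1`
  have hmid : ((P : ℤ) ∣ 2 * z 1 + ((r 1 : ℕ) : ℤ)) ↔ ((P : ℤ) ∣ 2 * z 1 + (1 - ((r 1 : ℕ) : ℤ)) - 1) := by
    have hlt : (r 1 : ℕ) < 2 := (r 1).isLt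
    rcases Nat.lt_succ_iff.mp hlt |>.eq_or_lt with h1 | h0
    · -- `r₁ = 1`: both sides are false (odd numbers)
      rw [h1]; push_cast
      constructor
      · intro h; have := h2.trans h; omega
      · intro h; have := h2.trans h; omega
    · have h0' : (r 1 : ℕ) = 0 := by omega
      rw [h0']; push_cast; simp
  unfold clsA clsB
  rw [hc, hc, hc, hc, hc, hc, hc, hc, hf0, hf2, hf3, hf1]
  exact and_congr Iff.rfl (and_congr hmid Iff.rfl)

/-- **BLOCK SUMS OF THE DIPOLE VANISH**: `Σ_{r ∈ {0,1}⁴} σ(2z + r) = 0` for every block corner `2z` (`P` even). [folklore] -/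
theorem sum_dip_block {P : ℕ} (hP : 2 ∣ P) (z : Site 4) : ∑ r : Fin 4 → Fin 2, dip P ((2 : ℤ) • z + boxVec 2 r) = 0 := by
  classical
  unfold dip
  rw [Finset.sum_sub_distrib, sub_eq_zero]
  -- reindex the second sum by the flip
  rw [← Equiv.sum_comp flipEquiv (fun r => if clsB P ((2 : ℤ) • z + boxVec 2 r) then (1 : ℝ) else 0)]
  refine Finset.sum_congr rfl fun r _ => ?_
  exact if_congr (clsA_iff_clsB_flip hP z r) rfl rfl

/-! ## §2 The generator `Λ₀ = i·1`, the dipole generator, the gauge and the field -/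

section Witness

/-- `Λ₀ = i·1` — a nonzero central skew matrix. -/
def Lam0 : Matrix n n ℂ := (Complex.I) • (1 : Matrix n n ℂ)

/-- `Λ₀` is skew. [folklore] -/
theorem Lam0_mem : (Lam0 : Matrix n n ℂ) ∈ skewAdjoint (Matrix n n ℂ) := by
  rw [skewAdjoint.mem_iff, Lam0, star_smul, star_one, Complex.star_def, Complex.conj_I, neg_smul]

/-- `Λ₀ ≠ 0`. [folklore] -/
theorem Lam0_ne_zero [Nonempty n] : (Lam0 : Matrix n n ℂ) ≠ 0 := smul_ne_zero Complex.I_ne_zero one_ne_zero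

/-- `‖Λ₀‖ > 0`. [folklore] -/
theorem norm_Lam0_pos [Nonempty n] : 0 < ‖(Lam0 : Matrix n n ℂ)‖ := norm_pos_iff.mpr Lam0_ne_zero

/-- THE DIPOLE GENERATOR `λ(y) = t·σ(y)·Λ₀`. -/
def lamD (P : ℕ) (t : ℝ) (y : Site 4) : Matrix n n ℂ := ((t * dip P y : ℝ) : ℂ) • Lam0

/-- `λ` is skew. [folklore] -/
theorem lamD_mem (P : ℕ) (t : ℝ) (y : Site 4) : (lamD P t y : Matrix n n ℂ) ∈ skewAdjoint (Matrix n n ℂ) := by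
  unfold lamD; rw [Complex.coe_smul]; exact skewAdjoint.smul_mem _ Lam0_mem

omit [Fintype n] in
/-- `λ` is `P`-periodic. [folklore] -/
theorem lamD_periodic (P : ℕ) (t : ℝ) (y : Site 4) (i : Fin 4) : (lamD P t (y + (P : ℤ) • e i) : Matrix n n ℂ) = lamD P t y := by
  simp only [lamD, dip_periodic]

omit [Fintype n] in
/-- `λ` vanishes on `2ℤ⁴`. [folklore] -/
theorem lamD_corner {P : ℕ} (hP : 2 ∣ P) (t : ℝ) (w : Site 4) : (lamD P t ((2 : ℤ) • w) : Matrix n n ℂ) = 0 := by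
  unfold lamD; rw [dip_corner hP w, mul_zero, Complex.ofReal_zero, zero_smul]

/-- `‖λ(y)‖ ≤ t‖Λ₀‖`. [folklore] -/
theorem norm_lamD_le (P : ℕ) {t : ℝ} (ht : 0 ≤ t) (y : Site 4) : ‖(lamD P t y : Matrix n n ℂ)‖ ≤ t * ‖(Lam0 : Matrix n n ℂ)‖ := by
  unfold lamD
  rw [norm_smul, Complex.norm_real, Real.norm_eq_abs, abs_mul, abs_of_nonneg ht]
  have h := abs_dip_le P y
  have : t * |dip P y| ≤ t := by nlinarith
  exact mul_le_mul_of_nonneg_right this (norm_nonneg _)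

/-- `‖λ(a)‖ = t‖Λ₀‖`. [folklore] -/
theorem norm_lamD_siteA {P : ℕ} (hP : 2 ≤ P) {t : ℝ} (ht : 0 ≤ t) : ‖(lamD P t siteA : Matrix n n ℂ)‖ = t * ‖(Lam0 : Matrix n n ℂ)‖ := by
  unfold lamD
  rw [dip_siteA hP, mul_one, norm_smul, Complex.norm_real, Real.norm_eq_abs, abs_of_nonneg ht]

omit [Fintype n] in
/-- Block sums of `λ` vanish. [folklore] -/
theorem sum_lamD_block {P : ℕ} (hP : 2 ∣ P) (t : ℝ) (z : Site 4) :
    ∑ r : Fin 4 → Fin 2, (lamD P t ((2 : ℤ) • z + boxVec 2 r) : Matrix n n ℂ) = 0 := by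
  unfold lamD
  rw [← Finset.sum_smul, ← Complex.ofReal_sum, ← Finset.mul_sum, sum_dip_block hP z, mul_zero, Complex.ofReal_zero, zero_smul]

/-- THE DIPOLE GAUGE `u(y) = exp λ(y)`. -/
def uD (P : ℕ) (t : ℝ) : Site 4 → (Matrix n n ℂ)ˣ := fun y => expUnit (lamD P t y)

/-- `u` is unitary. [folklore] -/
theorem uD_unitary (P : ℕ) (t : ℝ) : IsUnitarySite (uD (n := n) P t) := fun _ => expUnit_real_smul_mem_unitary Lam0_mem _

/-- `u = 1` on `2ℤ⁴`. [folklore] -/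
theorem uD_corner {P : ℕ} (hP : 2 ∣ P) (t : ℝ) (w : Site 4) : uD (n := n) P t ((2 : ℤ) • w) = 1 := by
  unfold uD; rw [lamD_corner hP]; exact T4AveragingDeficitWall.expUnit_zero

/-- THE DIPOLE FIELD `X = gaugeDir 1 λ`. -/
def XD (P : ℕ) (t : ℝ) : Site 4 → Fin 4 → Matrix n n ℂ := gaugeDir (1 : Site 4 → Fin 4 → (Matrix n n ℂ)ˣ) (lamD P t)

/-- `X(x, μ) = λ(x) − λ(x + e_μ)`. [folklore] -/
theorem XD_apply (P : ℕ) (t : ℝ) (x : Site 4) (μ : Fin 4) : XD (n := n) P t x μ = lamD P t x - lamD P t (x + e μ) := by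
  simp [XD, gaugeDir, Ad_one]

/-- `X` is skew. [folklore] -/
theorem XD_skew (P : ℕ) (t : ℝ) : IsSkewDir (XD (n := n) P t) := fun x μ => by
  rw [XD_apply]; exact (skewAdjoint _).sub_mem (lamD_mem P t x) (lamD_mem P t _)

/-- `X` is `P`-periodic. [folklore] -/
theorem XD_periodic (P : ℕ) (t : ℝ) : IsPeriodicDir (XD (n := n) P t) (P : ℤ) :=
  isPeriodicDir_gaugeDir (W := (1 : Site 4 → Fin 4 → (Matrix n n ℂ)ˣ)) (fun _ _ _ => rfl) (fun y i => lamD_periodic P t y i)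

/-- `‖X‖ ≤ 2t‖Λ₀‖`. [folklore] -/
theorem norm_XD_le (P : ℕ) {t : ℝ} (ht : 0 ≤ t) (x : Site 4) (μ : Fin 4) : ‖XD (n := n) P t x μ‖ ≤ 2 * (t * ‖(Lam0 : Matrix n n ℂ)‖) := by
  rw [XD_apply]
  exact (norm_sub_le _ _).trans (by linarith [norm_lamD_le (n := n) P ht x, norm_lamD_le (n := n) P ht (x + e μ)])

/-- **`1^{u} = 1·e^{X}`**: the dipole gauge transform of the trivial configuration is the right-chart perturbation by `X`. [folklore] -/
theorem gaugeAct_uD (P : ℕ) (t : ℝ) : gaugeAct (uD (n := n) P t) 1 = vary 1 (XD P t) 1 := by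
  funext x μ
  simp only [gaugeAct, vary, Pi.one_apply, mul_one, one_mul, Complex.ofReal_one, one_smul, XD_apply, uD, lamD, val_inv_expUnit,
    ← sub_smul, ← neg_smul, ← expUnit_add_smul, ← sub_eq_add_neg]

/-- `relPert 1 X = 1^{u}`. [folklore] -/
theorem relPert_XD (P : ℕ) (t : ℝ) : relPert 1 (XD (n := n) P t) = gaugeAct (uD P t) 1 := by
  rw [gaugeAct_uD]
  funext x μ
  simp [relPert, vary, Ad_one]

end Witness

end

end Summit.QuantumFields.BalabanUV.T4Continuum.NE7DipoleWitnessField
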